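import Mathlib.Analysis.SpecialFunctions.Pow.Real
import Mathlib.Analysis.InnerProductSpace.PiL2
import Mathlib.Analysis.Normed.Group.Bounded
import Mathlib.Analysis.Normed.Module.RCLike.Basic
import Mathlib.Topology.Algebra.Order.Field
import Mathlib.Topology.UniformSpace.UniformApproximation
import Mathlib.Topology.MetricSpace.Bounded
import Literature.Probability.LatticeModels.ScalingLimit
import HarnessLib

/-!
# First-order far-field (multipole-at-infinity) expansion of correlation families

Topic: Probability / LatticeModels (continuum `n`-point functions `S : CorrFamily d` on `ℝ^d`,
see `Literature.Probability.LatticeModels.ScalingLimit`; companion of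
`Literature.Probability.LatticeModels.ConformalCovariance`).

For `S : CorrFamily d`, a scaling dimension `Δ : ℝ`, `n : ℕ` and coefficient functions
`A₀ : (ℝ^d)^n → ℝ` (the *monopole*) and `A₁ : (ℝ^d)^n → ℝ^d` (the *dipole*) the predicate
`HasFarFieldExpansion S Δ n A₀ A₁` says that, as one point `y` recedes to infinity,

  `S_{n+1}(x, y) = ‖y‖^{-2Δ} [ A₀(x) + ŷ · A₁(x) / ‖y‖ + o(1/‖y‖) ]`,  `ŷ = y/‖y‖`,

locally uniformly in the non-coincident configuration `x ∈ NonCoincident d n`; precisely,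
`‖y‖^{2Δ+1} S (n+1) (Fin.snoc x y) - ‖y‖ A₀ x - ⟪A₁ x, ‖y‖⁻¹ • y⟫ → 0` locally uniformly on
`NonCoincident d n` as `y → ∞` (filter `cocompact`). This is first-order regularity at the
point at infinity of a quasi-primary field of dimension `Δ`: under the inversion `y ↦ y/‖y‖²` a
quasi-primary `φ` transforms with the factor `|∂x'/∂x|^{-Δ/d} = ‖y‖^{2Δ}`
(Di Francesco–Mathieu–Sénéchal, *Conformal Field Theory*, Springer 1997, §4.2.1,
eqs. (4.31)–(4.32)), so that `‖y‖^{2Δ} S_{n+1}(x, y)` is the correlator with one insertion at the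
image point `y/‖y‖² → 0` of the inverted frame, and `A₀`, `A₁` are its value and gradient there.
The predicate is used verbatim (inlined, `d = 3`) by the route `PrimaryAtInfinity` of
`Ising3DConformalLimit` (items `FirstMultipoleIdentity`, `FarFieldClustering`, `MultipoleToWard`).

## Main statements

* `HasFarFieldExpansion`, `hasFarFieldExpansion_iff` (`Iff.rfl`), the product-filter form
  `hasFarFieldExpansion_iff_tendsto` and the ray forms `tendsto_ray(_prod)`.
* `HasFarFieldExpansion.unique`: for `0 < d` the coefficients `(A₀, A₁)` are determined on
  `NonCoincident d n`.
* `HasFarFieldExpansion.continuousOn_monopole`, `HasFarFieldExpansion.continuousOn_dipole`: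
  if `S (n+1)` is continuous on `NonCoincident d (n+1)` then `A₀`, `A₁` are continuous on
  `NonCoincident d n` (symmetric average / antipodal difference along rays `y = ± t u`).
* `hasFarFieldExpansion_of_eq_zero`: the trivial expansion of a vanishing `S (n+1)`.

The explicit expansion of the pure power `c ‖x₀ - y‖^{-2Δ}` (monopole `c`, dipole `2Δ c x₀`)
and the behaviour under translations live in companion files.
Mathlib anchors (searched): `TendstoLocallyUniformlyOn`, `Filter.cocompact`,
`TendstoLocallyUniformlyOn.continuousOn`, `Fin.snoc_injective_iff`, `EuclideanSpace.basisFun`;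
Mathlib has no asymptotic expansions at infinity for families of correlation functions.

Design choices: the filter at infinity is `cocompact (EuclideanSpace ℝ (Fin d))` and uniformity
in `x` is `TendstoLocallyUniformlyOn … (NonCoincident d n)`, exactly as in the route file; the
remainder is normalised by `‖y‖^{2Δ+1}` so that no division by `S` or by powers of `‖y‖` occurs.
For `d = 0` the filter `cocompact` is trivial and the predicate is vacuous (hence `0 < d` in the
uniqueness statement).
-/

namespace Literature.Probability.LatticeModels

open Filter
open scoped Topology

section General

variable {ι α β : Type*} [TopologicalSpace α] [SeminormedAddCommGroup β]
  {F : ι → α → β} {f : α → β} {p : Filter ι} {s : Set α}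

/-- Locally uniform convergence on a set `s` of functions with values in a (semi)normed group,
rephrased as plain convergence of the difference `F i y - f y` to `0` along the product filters
`p ×ˢ 𝓝[s] x`, `x ∈ s` (reformulation of Mathlib's `tendstoLocallyUniformlyOn_iff_forall_tendsto`).
[folklore] -/
theorem tendstoLocallyUniformlyOn_iff_tendsto_sub_nhdsWithin :
    TendstoLocallyUniformlyOn F f p s ↔
      ∀ x ∈ s, Tendsto (fun q : ι × α => F q.1 q.2 - f q.2) (p ×ˢ 𝓝[s] x) (𝓝 0) := by
  rw [tendstoLocallyUniformlyOn_iff_forall_tendsto]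
  refine forall₂_congr fun x _ => ?_
  rw [tendsto_uniformity_iff_dist_tendsto_zero]
  simp only [dist_eq_norm']
  exact tendsto_zero_iff_norm_tendsto_zero.symm

/-- On an open set `s`, locally uniform convergence of normed-group-valued functions is plain
convergence of `F i y - f y` to `0` along `p ×ˢ 𝓝 x`, `x ∈ s`. [folklore] -/
theorem tendstoLocallyUniformlyOn_iff_tendsto_sub_nhds (hs : IsOpen s) :
    TendstoLocallyUniformlyOn F f p s ↔
      ∀ x ∈ s, Tendsto (fun q : ι × α => F q.1 q.2 - f q.2) (p ×ˢ 𝓝 x) (𝓝 0) := by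
  rw [tendstoLocallyUniformlyOn_iff_tendsto_sub_nhdsWithin]
  refine forall₂_congr fun x hx => ?_
  rw [hs.nhdsWithin_eq hx]

/-- A ray `t ↦ t • u` through a unit vector `u` of a real normed space leaves every compact set
as `t → +∞`. [folklore] -/
theorem tendsto_smul_atTop_cocompact {V : Type*} [NormedAddCommGroup V] [NormedSpace ℝ V]
    {u : V} (hu : ‖u‖ = 1) : Tendsto (fun t : ℝ => t • u) atTop (cocompact V) := by
  refine tendsto_cocompact_of_tendsto_dist_comp_atTop (0 : V) ?_
  simp only [dist_zero_right, norm_smul, hu, mul_one, Real.norm_eq_abs]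
  exact tendsto_abs_atTop_atTop

/-- If `t * a + c → 0` as `t → +∞` (`a c : ℝ` constants) then `a = 0` and `c = 0`. [folklore] -/
theorem eq_zero_of_tendsto_mul_add_atTop {a c : ℝ}
    (h : Tendsto (fun t : ℝ => t * a + c) atTop (𝓝 0)) : a = 0 ∧ c = 0 := by
  have h1 : Tendsto (fun t : ℝ => (t * a + c) * t⁻¹) atTop (𝓝 0) := by
    simpa using h.mul tendsto_inv_atTop_zero
  have h2 : Tendsto (fun t : ℝ => (t * a + c) * t⁻¹) atTop (𝓝 a) := by
    have h3 : Tendsto (fun t : ℝ => a + c * t⁻¹) atTop (𝓝 (a + c * 0)) :=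
      tendsto_const_nhds.add (tendsto_const_nhds.mul tendsto_inv_atTop_zero)
    rw [mul_zero, add_zero] at h3
    refine h3.congr' ?_
    filter_upwards [eventually_gt_atTop 0] with t ht
    rw [add_mul, mul_comm t a, mul_assoc, mul_inv_cancel₀ ht.ne', mul_one]
  have ha : a = 0 := tendsto_nhds_unique h2 h1
  refine ⟨ha, ?_⟩
  have hc : Tendsto (fun _ : ℝ => c) atTop (𝓝 0) := by simpa [ha] using h
  exact tendsto_const_nhds_iff.mp hc

end General

variable {d : ℕ}

/-- **First-order far-field (multipole-at-infinity) expansion** of a correlation family.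
For `S : CorrFamily d`, a scaling dimension `Δ`, `n : ℕ`, a monopole coefficient
`A₀ : (ℝ^d)^n → ℝ` and a dipole coefficient `A₁ : (ℝ^d)^n → ℝ^d`, the `(n+1)`-point function
satisfies, as the last point `y` recedes to infinity,
`S_{n+1}(x, y) = ‖y‖^{-2Δ} [A₀(x) + ŷ·A₁(x)/‖y‖ + o(1/‖y‖)]` locally uniformly in the
non-coincident configuration `x`; formally
`‖y‖^{2Δ+1} S (n+1) (Fin.snoc x y) - ‖y‖ A₀ x - ⟪A₁ x, ‖y‖⁻¹ • y⟫ → 0` locally uniformly on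
`NonCoincident d n` along `cocompact (ℝ^d)`. This is first-order regularity at the point at
infinity in the inverted frame of a quasi-primary field of dimension `Δ` (conformal factor
`‖y‖^{2Δ}` of the inversion), Di Francesco–Mathieu–Sénéchal 1997, §4.2.1, eqs. (4.31)–(4.32);
the verbatim inlined hypothesis of route PrimaryAtInfinity (Ising3DConformalLimit).
[cite: FrancescoMathieuSenechal1997, §4.2.1 eqs. (4.31)–(4.32)] -/
def HasFarFieldExpansion (S : CorrFamily d) (Δ : ℝ) (n : ℕ)
    (A₀ : (Fin n → EuclideanSpace ℝ (Fin d)) → ℝ)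
    (A₁ : (Fin n → EuclideanSpace ℝ (Fin d)) → EuclideanSpace ℝ (Fin d)) : Prop :=
  TendstoLocallyUniformlyOn
    (fun (y : EuclideanSpace ℝ (Fin d)) (x : Fin n → EuclideanSpace ℝ (Fin d)) =>
      ‖y‖ ^ (2 * Δ + 1) * S (n + 1) (Fin.snoc x y) - ‖y‖ * A₀ x - inner ℝ (A₁ x) (‖y‖⁻¹ • y))
    0 (cocompact (EuclideanSpace ℝ (Fin d))) (NonCoincident d n)

variable {S : CorrFamily d} {Δ : ℝ} {n : ℕ}
  {A₀ B₀ : (Fin n → EuclideanSpace ℝ (Fin d)) → ℝ}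
  {A₁ B₁ : (Fin n → EuclideanSpace ℝ (Fin d)) → EuclideanSpace ℝ (Fin d)}

/-- Unfolding of `HasFarFieldExpansion` (definitional; this is the form inlined in the route
PrimaryAtInfinity). (Di Francesco–Mathieu–Sénéchal 1997, §4.2.1.)
[cite: FrancescoMathieuSenechal1997, §4.2.1 eqs. (4.31)–(4.32)] -/
theorem hasFarFieldExpansion_iff :
    HasFarFieldExpansion S Δ n A₀ A₁ ↔
      TendstoLocallyUniformlyOn
        (fun (y : EuclideanSpace ℝ (Fin d)) (x : Fin n → EuclideanSpace ℝ (Fin d)) =>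
          ‖y‖ ^ (2 * Δ + 1) * S (n + 1) (Fin.snoc x y) - ‖y‖ * A₀ x
            - inner ℝ (A₁ x) (‖y‖⁻¹ • y))
        0 (cocompact (EuclideanSpace ℝ (Fin d))) (NonCoincident d n) :=
  Iff.rfl

/-- Product-filter form of the far-field expansion: for every non-coincident `x`, the remainder
`‖y‖^{2Δ+1} S_{n+1}(x', y) - ‖y‖ A₀ x' - ⟪A₁ x', ŷ⟫` tends to `0` as `(y, x') → (∞, x)`.
[folklore] -/
theorem hasFarFieldExpansion_iff_tendsto :
    HasFarFieldExpansion S Δ n A₀ A₁ ↔ ∀ x ∈ NonCoincident d n,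
      Tendsto (fun q : EuclideanSpace ℝ (Fin d) × (Fin n → EuclideanSpace ℝ (Fin d)) =>
          ‖q.1‖ ^ (2 * Δ + 1) * S (n + 1) (Fin.snoc q.2 q.1) - ‖q.1‖ * A₀ q.2
            - inner ℝ (A₁ q.2) (‖q.1‖⁻¹ • q.1))
        (cocompact (EuclideanSpace ℝ (Fin d)) ×ˢ 𝓝 x) (𝓝 0) := by
  rw [HasFarFieldExpansion, tendstoLocallyUniformlyOn_iff_tendsto_sub_nhds (isOpen_nonCoincident d n)]
  simp only [Pi.zero_apply, sub_zero]

/-- Pointwise consequence of the far-field expansion at a non-coincident configuration `x`: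
the remainder tends to `0` as `y → ∞`. [folklore] -/
theorem HasFarFieldExpansion.tendsto_at (h : HasFarFieldExpansion S Δ n A₀ A₁)
    {x : Fin n → EuclideanSpace ℝ (Fin d)} (hx : x ∈ NonCoincident d n) :
    Tendsto (fun y : EuclideanSpace ℝ (Fin d) =>
        ‖y‖ ^ (2 * Δ + 1) * S (n + 1) (Fin.snoc x y) - ‖y‖ * A₀ x - inner ℝ (A₁ x) (‖y‖⁻¹ • y))
      (cocompact (EuclideanSpace ℝ (Fin d))) (𝓝 0) := by
  simpa using TendstoLocallyUniformlyOn.tendsto_at h hx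

/-- The far-field expansion read along rays `y = t • u`, `‖u‖ = 1`, locally uniformly in the
configuration: `t^{2Δ+1} S_{n+1}(x', t u) - t A₀ x' - ⟪A₁ x', u⟫ → 0` as `(t, x') → (+∞, x)`.
[folklore] -/
theorem HasFarFieldExpansion.tendsto_ray_prod (h : HasFarFieldExpansion S Δ n A₀ A₁)
    {x : Fin n → EuclideanSpace ℝ (Fin d)} (hx : x ∈ NonCoincident d n)
    {u : EuclideanSpace ℝ (Fin d)} (hu : ‖u‖ = 1) :
    Tendsto (fun q : ℝ × (Fin n → EuclideanSpace ℝ (Fin d)) =>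
        q.1 ^ (2 * Δ + 1) * S (n + 1) (Fin.snoc q.2 (q.1 • u)) - q.1 * A₀ q.2
          - inner ℝ (A₁ q.2) u)
      (atTop ×ˢ 𝓝 x) (𝓝 0) := by
  have H := (hasFarFieldExpansion_iff_tendsto.mp h x hx).comp
    ((tendsto_smul_atTop_cocompact hu).prodMap (tendsto_id (x := 𝓝 x)))
  refine H.congr' ?_
  filter_upwards [(eventually_gt_atTop (0 : ℝ)).prod_inl (𝓝 x)] with q hq
  have hn : ‖q.1 • u‖ = q.1 := by
    rw [norm_smul, hu, mul_one, Real.norm_eq_abs, abs_of_pos hq]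
  simp only [Function.comp_apply, Prod.map_fst, Prod.map_snd, id_eq, hn, smul_smul,
    inv_mul_cancel₀ hq.ne', one_smul]

/-- The far-field expansion read along a ray `y = t • u`, `‖u‖ = 1`, at a fixed non-coincident
configuration `x`: `t^{2Δ+1} S_{n+1}(x, t u) - t A₀ x - ⟪A₁ x, u⟫ → 0` as `t → +∞`.
[folklore] -/
theorem HasFarFieldExpansion.tendsto_ray (h : HasFarFieldExpansion S Δ n A₀ A₁)
    {x : Fin n → EuclideanSpace ℝ (Fin d)} (hx : x ∈ NonCoincident d n)
    {u : EuclideanSpace ℝ (Fin d)} (hu : ‖u‖ = 1) :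
    Tendsto (fun t : ℝ => t ^ (2 * Δ + 1) * S (n + 1) (Fin.snoc x (t • u)) - t * A₀ x
        - inner ℝ (A₁ x) u) atTop (𝓝 0) := by
  refine ((h.tendsto_at hx).comp (tendsto_smul_atTop_cocompact hu)).congr' ?_
  filter_upwards [eventually_gt_atTop (0 : ℝ)] with t ht
  have hn : ‖t • u‖ = t := by
    rw [norm_smul, hu, mul_one, Real.norm_eq_abs, abs_of_pos ht]
  simp only [Function.comp_apply, hn, smul_smul, inv_mul_cancel₀ ht.ne', one_smul]

/-! ### Uniqueness of the coefficients -/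

/-- **Uniqueness of the far-field coefficients.** In dimension `d ≥ 1`, two pairs `(A₀, A₁)` and
`(B₀, B₁)` of monopole/dipole coefficients of the same family `S` (same `Δ`, `n`) agree at every
non-coincident configuration. (For `d = 0` the filter at infinity is trivial and the predicate is
vacuous.) [folklore] -/
theorem HasFarFieldExpansion.unique (hd : 0 < d) (hA : HasFarFieldExpansion S Δ n A₀ A₁)
    (hB : HasFarFieldExpansion S Δ n B₀ B₁) {x : Fin n → EuclideanSpace ℝ (Fin d)}
    (hx : x ∈ NonCoincident d n) : A₀ x = B₀ x ∧ A₁ x = B₁ x := by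
  have key : ∀ u : EuclideanSpace ℝ (Fin d), ‖u‖ = 1 →
      B₀ x - A₀ x = 0 ∧ inner ℝ (B₁ x - A₁ x) u = 0 := by
    intro u hu
    apply eq_zero_of_tendsto_mul_add_atTop
    have H := (hA.tendsto_ray hx hu).sub (hB.tendsto_ray hx hu)
    rw [sub_zero] at H
    refine H.congr' (Eventually.of_forall fun t => ?_)
    simp only [inner_sub_left]
    ring
  obtain ⟨h0, -⟩ := key (EuclideanSpace.single ⟨0, hd⟩ 1) (by simp)
  refine ⟨(sub_eq_zero.mp h0).symm, ?_⟩
  by_contra hne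
  have hv : B₁ x - A₁ x ≠ 0 := sub_ne_zero.mpr (Ne.symm hne)
  have hu : ‖(‖B₁ x - A₁ x‖⁻¹ : ℝ) • (B₁ x - A₁ x)‖ = 1 := norm_smul_inv_norm hv
  have h1 := (key _ hu).2
  rw [real_inner_smul_right, real_inner_self_eq_norm_sq] at h1
  rcases mul_eq_zero.mp h1 with h2 | h2
  · exact hv (norm_eq_zero.mp (inv_eq_zero.mp h2))
  · exact hv (norm_eq_zero.mp ((pow_eq_zero_iff two_ne_zero).mp h2))

/-! ### Continuity of the coefficients -/

/-- Appending a point to a configuration is continuous in the configuration. [folklore] -/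
theorem continuous_snoc_const {X : Type*} [TopologicalSpace X] {m : ℕ} (y : X) :
    Continuous fun x : Fin m → X => (Fin.snoc x y : Fin (m + 1) → X) := by
  refine continuous_pi fun j => ?_
  refine Fin.lastCases ?_ (fun i => ?_) j
  · simp only [Fin.snoc_last]
    exact continuous_const
  · simp only [Fin.snoc_castSucc]
    exact continuous_apply i

/-- Appending a point not already present to a non-coincident configuration gives a
non-coincident configuration. [folklore] -/
theorem snoc_mem_nonCoincident {m : ℕ} {x : Fin m → EuclideanSpace ℝ (Fin d)}
    (hx : x ∈ NonCoincident d m) {y : EuclideanSpace ℝ (Fin d)} (hy : ∀ i, x i ≠ y) :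
    (Fin.snoc x y : Fin (m + 1) → EuclideanSpace ℝ (Fin d)) ∈ NonCoincident d (m + 1) := by
  rw [mem_nonCoincident] at hx ⊢
  exact Fin.snoc_injective_iff.mpr ⟨hx, fun ⟨i, hi⟩ => hy i hi⟩

/-- Local geometry of `NonCoincident`: every non-coincident `x₀` has an open neighbourhood `V`
of non-coincident configurations and a radius `M > 0` such that appending any point of norm
`≥ M` to any `x ∈ V` stays non-coincident. [folklore] -/
theorem exists_open_nhd_snoc_mem {x₀ : Fin n → EuclideanSpace ℝ (Fin d)}
    (hx₀ : x₀ ∈ NonCoincident d n) :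
    ∃ V : Set (Fin n → EuclideanSpace ℝ (Fin d)), IsOpen V ∧ x₀ ∈ V ∧ V ⊆ NonCoincident d n ∧
      ∃ M : ℝ, 0 < M ∧ ∀ x ∈ V, ∀ y : EuclideanSpace ℝ (Fin d), M ≤ ‖y‖ →
        (Fin.snoc x y : Fin (n + 1) → EuclideanSpace ℝ (Fin d)) ∈ NonCoincident d (n + 1) := by
  set M : ℝ := 1 + ∑ i, ‖x₀ i‖ with hM_def
  have hM : ∀ i, ‖x₀ i‖ < M := fun i => by
    have := Finset.single_le_sum (fun j _ => norm_nonneg (x₀ j)) (Finset.mem_univ i)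
    rw [hM_def]
    linarith
  have hM0 : 0 < M := by
    rw [hM_def]
    linarith [Finset.sum_nonneg fun i (_ : i ∈ Finset.univ) => norm_nonneg (x₀ i)]
  refine ⟨NonCoincident d n ∩ {x | ∀ i, ‖x i‖ < M}, ?_, ⟨hx₀, hM⟩, Set.inter_subset_left,
    M, hM0, ?_⟩
  · refine (isOpen_nonCoincident d n).inter ?_
    simp only [Set.setOf_forall]
    exact isOpen_iInter_of_finite fun i =>
      isOpen_lt (continuous_norm.comp (continuous_apply i)) continuous_const
  · rintro x ⟨hx, hxM⟩ y hy
    refine snoc_mem_nonCoincident hx fun i hi => ?_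
    have := hxM i
    rw [hi] at this
    linarith

/-- Continuity of the slices `x ↦ S_{n+1}(x, t u)` on a set of configurations avoiding the
sphere of radius `|t|`. [folklore] -/
theorem continuousOn_corr_snoc_smul (hS : ContinuousOn (S (n + 1)) (NonCoincident d (n + 1)))
    {V : Set (Fin n → EuclideanSpace ℝ (Fin d))} {M : ℝ}
    (hV : ∀ x ∈ V, ∀ y : EuclideanSpace ℝ (Fin d), M ≤ ‖y‖ →
      (Fin.snoc x y : Fin (n + 1) → EuclideanSpace ℝ (Fin d)) ∈ NonCoincident d (n + 1))
    {u : EuclideanSpace ℝ (Fin d)} (hu : ‖u‖ = 1) {t : ℝ} (ht : M ≤ |t|) :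
    ContinuousOn (fun x => S (n + 1) (Fin.snoc x (t • u))) V :=
  hS.comp (continuous_snoc_const (t • u)).continuousOn fun x hx =>
    hV x hx _ (by rwa [norm_smul, hu, mul_one, Real.norm_eq_abs])

/-- **Continuity of the monopole coefficient.** If `S (n+1)` is continuous on non-coincident
configurations, the monopole coefficient `A₀` of a far-field expansion is continuous on
`NonCoincident d n`: `A₀` is the locally uniform limit of the continuous symmetric averages
`x ↦ (2t)⁻¹ t^{2Δ+1} (S_{n+1}(x, t u) + S_{n+1}(x, -t u))`. [folklore] -/
theorem HasFarFieldExpansion.continuousOn_monopole (h : HasFarFieldExpansion S Δ n A₀ A₁)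
    (hS : ContinuousOn (S (n + 1)) (NonCoincident d (n + 1))) :
    ContinuousOn A₀ (NonCoincident d n) := by
  rcases Nat.eq_zero_or_pos d with rfl | hd
  · exact (continuous_of_const fun x y => by rw [Subsingleton.elim x y]).continuousOn
  intro x₀ hx₀
  obtain ⟨V, hVo, hxV, hVs, M, -, hV⟩ := exists_open_nhd_snoc_mem hx₀
  suffices hA : ContinuousOn A₀ V from (hA.continuousAt (hVo.mem_nhds hxV)).continuousWithinAt
  set u : EuclideanSpace ℝ (Fin d) := EuclideanSpace.single ⟨0, hd⟩ 1 with hu_def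
  have hu : ‖u‖ = 1 := by simp [hu_def]
  have hu' : ‖-u‖ = 1 := by rw [norm_neg, hu]
  set G : ℝ → (Fin n → EuclideanSpace ℝ (Fin d)) → ℝ := fun t x =>
    2⁻¹ * t⁻¹ * (t ^ (2 * Δ + 1) * S (n + 1) (Fin.snoc x (t • u))
      + t ^ (2 * Δ + 1) * S (n + 1) (Fin.snoc x (t • -u))) with hG_def
  have hG : TendstoLocallyUniformlyOn G A₀ atTop V := by
    rw [tendstoLocallyUniformlyOn_iff_tendsto_sub_nhds hVo]
    intro x hx
    have hinv : Tendsto (fun q : ℝ × (Fin n → EuclideanSpace ℝ (Fin d)) => (2 : ℝ)⁻¹ * q.1⁻¹)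
        (atTop ×ˢ 𝓝 x) (𝓝 0) := by
      simpa using (tendsto_inv_atTop_zero.comp tendsto_fst).const_mul (2 : ℝ)⁻¹
    have H := hinv.mul ((h.tendsto_ray_prod (hVs hx) hu).add (h.tendsto_ray_prod (hVs hx) hu'))
    rw [add_zero, mul_zero] at H
    refine H.congr' ?_
    filter_upwards [(eventually_gt_atTop (0 : ℝ)).prod_inl (𝓝 x)] with q hq
    simp only [hG_def, inner_neg_right]
    field_simp
    ring
  have hGc : ∀ᶠ t in atTop, ContinuousOn (G t) V := by
    filter_upwards [eventually_ge_atTop M, eventually_gt_atTop (0 : ℝ)] with t htM ht0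
    have habs : M ≤ |t| := by rwa [abs_of_pos ht0]
    simp only [hG_def]
    exact continuousOn_const.mul
      ((continuousOn_const.mul (continuousOn_corr_snoc_smul hS hV hu habs)).add
        (continuousOn_const.mul (continuousOn_corr_snoc_smul hS hV hu' habs)))
  exact hG.continuousOn hGc.frequently

/-- **Continuity of the dipole coefficient.** If `S (n+1)` is continuous on non-coincident
configurations, the dipole coefficient `A₁` of a far-field expansion is continuous on
`NonCoincident d n`: each component `⟪A₁ x, e_j⟫` is the locally uniform limit of the continuous
antipodal differences `x ↦ ½ t^{2Δ+1} (S_{n+1}(x, t e_j) - S_{n+1}(x, -t e_j))`. [folklore] -/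
theorem HasFarFieldExpansion.continuousOn_dipole (h : HasFarFieldExpansion S Δ n A₀ A₁)
    (hS : ContinuousOn (S (n + 1)) (NonCoincident d (n + 1))) :
    ContinuousOn A₁ (NonCoincident d n) := by
  classical
  -- reduction to the components along the standard orthonormal basis
  suffices hcoord : ∀ j : Fin d, ContinuousOn
      (fun x => inner ℝ (A₁ x) (EuclideanSpace.single j (1 : ℝ))) (NonCoincident d n) by
    have hrepr : A₁ = fun x => ∑ j, inner ℝ (A₁ x) (EuclideanSpace.single j (1 : ℝ)) •
        EuclideanSpace.single j (1 : ℝ) := by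
      funext x
      have hb := (EuclideanSpace.basisFun (Fin d) ℝ).sum_repr' (A₁ x)
      simp only [EuclideanSpace.basisFun_apply] at hb
      calc A₁ x = ∑ i, inner ℝ (EuclideanSpace.single i (1 : ℝ)) (A₁ x) •
            EuclideanSpace.single i (1 : ℝ) := hb.symm
        _ = _ := Finset.sum_congr rfl fun j _ => by rw [real_inner_comm]
    rw [hrepr]
    exact continuousOn_finsetSum _ fun j _ => (hcoord j).smul continuousOn_const
  intro j x₀ hx₀
  obtain ⟨V, hVo, hxV, hVs, M, -, hV⟩ := exists_open_nhd_snoc_mem hx₀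
  set u : EuclideanSpace ℝ (Fin d) := EuclideanSpace.single j (1 : ℝ) with hu_def
  suffices hA : ContinuousOn (fun x => inner ℝ (A₁ x) u) V from
    (hA.continuousAt (hVo.mem_nhds hxV)).continuousWithinAt
  have hu : ‖u‖ = 1 := by simp [hu_def]
  have hu' : ‖-u‖ = 1 := by rw [norm_neg, hu]
  set G : ℝ → (Fin n → EuclideanSpace ℝ (Fin d)) → ℝ := fun t x =>
    2⁻¹ * (t ^ (2 * Δ + 1) * S (n + 1) (Fin.snoc x (t • u))
      - t ^ (2 * Δ + 1) * S (n + 1) (Fin.snoc x (t • -u))) with hG_def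
  have hG : TendstoLocallyUniformlyOn G (fun x => inner ℝ (A₁ x) u) atTop V := by
    rw [tendstoLocallyUniformlyOn_iff_tendsto_sub_nhds hVo]
    intro x hx
    have H := ((h.tendsto_ray_prod (hVs hx) hu).sub (h.tendsto_ray_prod (hVs hx) hu')).const_mul
      (2 : ℝ)⁻¹
    rw [sub_zero, mul_zero] at H
    refine H.congr' (Eventually.of_forall fun q => ?_)
    simp only [hG_def, inner_neg_right]
    ring
  have hGc : ∀ᶠ t in atTop, ContinuousOn (G t) V := by
    filter_upwards [eventually_ge_atTop M, eventually_gt_atTop (0 : ℝ)] with t htM ht0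
    have habs : M ≤ |t| := by rwa [abs_of_pos ht0]
    simp only [hG_def]
    exact continuousOn_const.mul
      ((continuousOn_const.mul (continuousOn_corr_snoc_smul hS hV hu habs)).sub
        (continuousOn_const.mul (continuousOn_corr_snoc_smul hS hV hu' habs)))
  exact hG.continuousOn hGc.frequently

/-! ### Elementary closure properties -/

/-- A family whose `(n+1)`-point function vanishes identically (e.g. odd correlations of an even
model) has the trivial far-field expansion `A₀ = 0`, `A₁ = 0`. [folklore] -/
theorem hasFarFieldExpansion_of_eq_zero
    (hS : ∀ z : Fin (n + 1) → EuclideanSpace ℝ (Fin d), S (n + 1) z = 0) :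
    HasFarFieldExpansion S Δ n 0 0 := by
  rw [hasFarFieldExpansion_iff_tendsto]
  intro x _
  simp only [hS, mul_zero, Pi.zero_apply, inner_zero_left, sub_self]
  exact tendsto_const_nhds

end Literature.Probability.LatticeModels
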